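import Literature.AlgebraicTopology.Homotopy.ManifoldCountableCWType
import Literature.AlgebraicTopology.Homotopy.CellularApproximationProofs
import HarnessLib

/-!
# Manifolds have the homotopy type of countable CW complexes (Milnor 1959, Cor. 1) — proof

Topic `Literature/AlgebraicTopology/Homotopy`. Discharge of the named fact
`Literature.AlgebraicTopology.Homotopy.Manifold.exists_cwComplex_homotopyEquiv` of
`WhiteheadContractibleLeaves.lean` (Milnor, *On spaces having the homotopy type of a CW-complex*,
Trans. AMS 90 (1959), Cor. 1, p. 272: every separable manifold has the homotopy type of a
countable CW complex; vendored for Hausdorff second countable topological `n`-manifolds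
`ChartedSpace (EuclideanSpace ℝ (Fin n)) M`):

* `Manifold.exists_cwComplex_homotopyEquiv_holds : Manifold.exists_cwComplex_homotopyEquiv`.

(The recognition principle `Manifold.contractibleSpace_of_simplyConnected_of_acyclic` from
Hurewicz alone is already `Manifold.contractibleSpace_of_simplyConnected_of_acyclic_of_hurewicz`
in `WeaklyContractibleManifold.lean`, by a different route.)

The proof is the tree's telescope route `ManifoldCountableCWType.lean` (compact exhaustion,
factorization of compact pieces through finite cube complexes up to small homotopy
`exists_cube_factorization`, mapping telescopes `SeqTelescope.*` and their CW structure), whose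
only remaining hypothesis, Hatcher's cellular approximation theorem (*Algebraic Topology* (2002),
Thm. 4.8), is `cellularApproximation_holds` (`CellularApproximationProofs.lean`). Milnor's own
route (separable manifolds are ANRs, Hanner; Thm. 1 (d) ⇒ (a) via nerves and Whitehead's
theorem) is thereby bypassed. No named facts, no `sorry`.

## References

* J. Milnor, *On spaces having the homotopy type of a CW-complex*, Trans. AMS 90 (1959),
  272–280, Cor. 1 (p. 272). [Milnor1959]
* A. Hatcher, *Algebraic Topology*, CUP (2002), Thm. 4.8 (p. 349), Prop. A.11 (p. 528).
  [HatcherAT2002]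
-/

noncomputable section

namespace Literature.AlgebraicTopology.Homotopy

universe u

/-- **Milnor 1959, Corollary 1** (p. 272: "Every separable manifold is of the same homotopy type
as a countable CW-complex"), discharging the named fact `Manifold.exists_cwComplex_homotopyEquiv`:
every Hausdorff second countable topological `n`-manifold has the homotopy type of a countable
(Hausdorff) CW complex. PROVED, by the telescope route given cellular approximation
(`Manifold.exists_cwComplex_homotopyEquiv_of_cellularApproximation`) and the cellular
approximation theorem (`cellularApproximation_holds`). [cite: Milnor1959, Cor. 1 (p. 272)] -/
theorem Manifold.exists_cwComplex_homotopyEquiv_holds : Manifold.exists_cwComplex_homotopyEquiv.{u} :=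
  Manifold.exists_cwComplex_homotopyEquiv_of_cellularApproximation cellularApproximation_holds.{0, 0}

end Literature.AlgebraicTopology.Homotopy

end
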